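import Literature.Analysis.FluidPDE.BurgersVortexPeakSpeed
import Literature.Analysis.FluidPDE.Vorticity
import HarnessLib

/-!
# The Burgers vortex is exactly aligned: `Sω = γω`, stretching rate `α = γ`, tilting `χ = 0`
# (Galanti–Gibbon–Heritage 1997, §4)

Analysis/FluidPDE proof file (everything PROVED; no definitions, no named facts), companion of
`BurgersVortex.lean` / `BurgersVortexSteady.lean` (the Burgers vortex
`u = (−γx₀/2, −γx₁/2, γx₂) + v_θ(r)e_θ` as an exact steady Navier–Stokes solution) and of
`VorticityDirectionDynamics.lean` (the pointwise `|ω|`/`ξ` dynamics in the stretching rate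
`α = ⟪ξ, ∇u ξ⟫` and the tilting vector `∇u ξ − αξ`).

B. Galanti, J. D. Gibbon, M. Heritage, *Vorticity alignment results for the three-dimensional Euler
and Navier–Stokes equations*, Nonlinearity 10 (1997) 1675–1694 = arXiv:chao-dyn/9709003, §4
"Burgers vortex tubes and shear layers" (render `paper-arxiv-chao-dyn_9709003/p0009.txt` L8–L14),
verbatim:

> In addition, using the solution for `ω` and the form of `S`, in both cases [Burgers vortex
> tube and Burgers shear layer] `α = γ`, `χ = 0`, ((alphab1)) with corresponding angle `φ = 0`,
> reflecting the fact that there is exact alignment between `ω` and `e₃` with this fixed point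
> sitting on the `α`-axis.

(`α = ξ·Sξ` the stretching rate, `χ = ξ × Sξ` the tilting vector, `ξ = ω/|ω|`, GGH97 §1 p. 3.)

## What is proved (for the tree's `burgersVortex γ ν Γ`, all `γ, ν, Γ`, every point `x`)

* `fderiv_burgersVortex_apply_axis` — `∇u e₃ = γ e₃` (the axial direction is an eigenvector of
  the velocity gradient with eigenvalue the strain rate `γ`);
* `burgersVortex_stretching_eq` — **`∇u ω = γ ω`** (`ω = curl u = ω(r) e₃`; here `∇u ω = Sω`
  since the antisymmetric part of `∇u` annihilates `ω`): GGH97 (alphab1) in vector form;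
* `burgersVortex_tiltingFree` — **`ω × ∇u ω = 0`** (`χ = 0`);
* `burgersVortex_stretchingRate` — **`α = ⟪ξ, ∇u ξ⟫ = γ`** wherever `ω ≠ 0`
  (`ξ = vorticityDirection (curl u)`);
* `burgersVortex_apply_vorticityDirection` — `∇u ξ = γ ξ` (the tilting vector
  `∇u ξ − αξ` vanishes: the hypothesis `htilt` of
  `VorticityDirectionDynamics.NavierStokes.hasDerivAt_vorticityDirection_of_tiltingFree`).

## Rendering

`S` in GGH97 is the symmetric part of `∇u`; for `h = ω` (and `h = ξ ∥ ω`) one has `∇u h = Sh`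
because `(∇u − ∇uᵀ)h = ω × h = 0`, so the statements are written with the full gradient
`fderiv ℝ (burgersVortex γ ν Γ) x`, the form used by the tree's vorticity equation and by the
door files (`cross (curlCLM A) (A (curlCLM A))` with `A = ∇u`).  The Burgers shear layer
(`burgersLayer`, the second case of (alphab1)) is not treated here.  WHAT THIS IS NOT: not a
regularity statement — exact kinematics of one explicit steady solution (infinite energy), the
printed example of a tilting-free ("φ = 0") flow.

## References

* B. Galanti, J. D. Gibbon, M. Heritage, Nonlinearity 10 (1997) 1675–1694 =
  arXiv:chao-dyn/9709003, §4 displays (Sf1), (BS1), (alphab1)–(alphab3) (arXiv p. 8–9).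
  [`GalantiGibbonHeritage1997`]
* U. Frisch, *Turbulence* (1995), §8.9.1, (8.140) (the Burgers vortex; the tree's
  `burgersVortex`). [`Frisch1995`]
-/

noncomputable section

open MeasureTheory Set Function Filter
open scoped RealInnerProductSpace Matrix

namespace Literature.Analysis.FluidPDE

namespace BurgersVortexTiltingFree

/-- The axial unit vector `e₃` (index `2`) has `x₀ = x₁ = 0` components and is killed by the
rotation generator: `J e₃ = 0`. [folklore] -/
private theorem rotGen_axis : rotGen (EuclideanSpace.single 2 (1 : ℝ)) = 0 := rotGen_single_two

/-- **`∇u e₃ = γ e₃` for the Burgers vortex**: the strain contributes `γ e₃` and the swirl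
gradient annihilates the axial direction (`Dv(x) h = c₁(x₀h₀ + x₁h₁) Jx + c₂ Jh` vanishes for
`h = e₃`). (GGH97 §4, (BS1): `e₃` is the eigenvector of `S` with eigenvalue `γ`.)
[cite: GalantiGibbonHeritage1997, §4 (BS1)–(alphab1) (arXiv:chao-dyn/9709003 pp. 8–9)] -/
theorem fderiv_burgersVortex_apply_axis (γ ν Γ : ℝ) (x : EuclideanSpace ℝ (Fin 3)) :
    fderiv ℝ (burgersVortex γ ν Γ) x (EuclideanSpace.single 2 1) =
      γ • EuclideanSpace.single 2 (1 : ℝ) := by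
  have hd1 : DifferentiableAt ℝ (axisymmetricStrain γ) x :=
    ((contDiff_axisymmetricStrain γ (n := 1)).differentiable one_ne_zero) x
  have hd2 : DifferentiableAt ℝ (burgersVortexSwirl γ ν Γ) x :=
    ((contDiff_burgersVortexSwirl γ ν Γ (n := 1)).differentiable one_ne_zero) x
  have hstrain : fderiv ℝ (axisymmetricStrain γ) x (EuclideanSpace.single 2 1) =
      γ • EuclideanSpace.single 2 (1 : ℝ) := by
    rw [axisymmetricStrain, (hasFDerivAt_linearStrain _ _ _ x).fderiv, linearStrainL_apply]
    ext i
    fin_cases i <;> simp [linearStrain]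
  have hswirl : fderiv ℝ (burgersVortexSwirl γ ν Γ) x (EuclideanSpace.single 2 1) = 0 := by
    rw [fderiv_burgersVortexSwirl_apply, rotGen_axis, smul_zero, add_zero]
    simp
  rw [show burgersVortex γ ν Γ = fun y => axisymmetricStrain γ y + burgersVortexSwirl γ ν Γ y
      from rfl, fderiv_fun_add hd1 hd2, _root_.add_apply, hstrain, hswirl, add_zero]

/-- **GGH97 (alphab1), vector form: `Sω = ∇u ω = γ ω` for the Burgers vortex** — the vorticity
`ω = ω(r) e₃` is an exact eigenvector of the velocity gradient with eigenvalue the strain rate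
("`α = γ`, `χ = 0` … exact alignment between `ω` and `e₃`").
[cite: GalantiGibbonHeritage1997, §4 (alphab1) (arXiv:chao-dyn/9709003 p. 9)] -/
theorem burgersVortex_stretching_eq (γ ν Γ : ℝ) (x : EuclideanSpace ℝ (Fin 3)) :
    fderiv ℝ (burgersVortex γ ν Γ) x (curl (burgersVortex γ ν Γ) x) =
      γ • curl (burgersVortex γ ν Γ) x := by
  rw [curl_burgersVortex, map_smul, fderiv_burgersVortex_apply_axis, smul_comm]

/-- `a × (c a) = 0`. [folklore] -/
private theorem cross_self_smul_btf (a : EuclideanSpace ℝ (Fin 3)) (c : ℝ) : cross a (c • a) = 0 := by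
  apply WithLp.ofLp_injective (p := 2)
  show WithLp.ofLp a ⨯₃ WithLp.ofLp (c • a) = WithLp.ofLp (0 : EuclideanSpace ℝ (Fin 3))
  rw [WithLp.ofLp_smul, LinearMap.map_smul, cross_self, smul_zero, WithLp.ofLp_zero]

/-- **The Burgers vortex is tilting-free: `ω × ∇u ω = 0`** at every point (GGH97 §4: `χ = 0`,
`φ = 0`). [cite: GalantiGibbonHeritage1997, §4 (alphab1), (alphab3) (arXiv:chao-dyn/9709003 p. 9)] -/
theorem burgersVortex_tiltingFree (γ ν Γ : ℝ) (x : EuclideanSpace ℝ (Fin 3)) :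
    cross (curl (burgersVortex γ ν Γ) x)
        (fderiv ℝ (burgersVortex γ ν Γ) x (curl (burgersVortex γ ν Γ) x)) = 0 := by
  rw [burgersVortex_stretching_eq]
  exact cross_self_smul_btf _ _

/-- **`∇u ξ = γ ξ` for the vorticity direction of the Burgers vortex**: the tilting vector
`∇u ξ − αξ` vanishes with `α = γ` (GGH97 §4 (alphab1): "`α = γ`, `χ = 0`"); at points with `ω = 0`
both sides are the junk value `0`. [cite: GalantiGibbonHeritage1997, §4 (alphab1) (arXiv:chao-dyn/9709003 p. 9)] -/
theorem burgersVortex_apply_vorticityDirection (γ ν Γ : ℝ) (x : EuclideanSpace ℝ (Fin 3)) :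
    fderiv ℝ (burgersVortex γ ν Γ) x (vorticityDirection (curl (burgersVortex γ ν Γ)) x) =
      γ • vorticityDirection (curl (burgersVortex γ ν Γ)) x := by
  rw [vorticityDirection_apply, map_smul, burgersVortex_stretching_eq, smul_comm]

/-- **The stretching rate of the Burgers vortex is the strain rate: `α = ⟪ξ, ∇u ξ⟫ = γ`** wherever
`ω ≠ 0` (GGH97 §4 (alphab1): "`α = γ`"; `ξ·Sξ = ⟪ξ, ∇u ξ⟫`).
[cite: GalantiGibbonHeritage1997, §4 (alphab1) (arXiv:chao-dyn/9709003 p. 9)] -/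
theorem burgersVortex_stretchingRate (γ ν Γ : ℝ) {x : EuclideanSpace ℝ (Fin 3)}
    (hx : curl (burgersVortex γ ν Γ) x ≠ 0) :
    ⟪vorticityDirection (curl (burgersVortex γ ν Γ)) x,
        fderiv ℝ (burgersVortex γ ν Γ) x (vorticityDirection (curl (burgersVortex γ ν Γ)) x)⟫ =
      γ := by
  rw [burgersVortex_apply_vorticityDirection γ ν Γ x, real_inner_smul_right,
    real_inner_self_eq_norm_sq, norm_vorticityDirection _ hx, one_pow, mul_one]

end BurgersVortexTiltingFree

end Literature.Analysis.FluidPDE
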